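import Literature.AlgebraicTopology.CharacteristicClasses.WhitneySumFormula
import Literature.AlgebraicTopology.CharacteristicClasses.TautologicalChernClass
import HarnessLib

/-!
# Existence of Chern classes: the discharge of `chernClassTheory_nonempty`

D. Husemoller, *Fibre Bundles* (3rd ed. 1994), Ch. 17: Def. 2.6 (the classes via the projective
bundle and the Leray–Hirsch theorem), Prop. 3.3 ((C₀), (C₁), (C₃)) and Thm. 6.2 ((C₂), the Whitney
sum formula), for bundles over paracompact Hausdorff bases ((2.4)). Assembling
`GrothendieckChernClasses` ((C₀), (C₁)), `WhitneySumFormula` ((C₂)) and `WhitneyLineCase` /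
`TautologicalChernClass` ((C₃): `c₁(γ¹) = -e(γ¹)` generates `H²(ℂP¹; ℤ)`) over `R = ℤ`:

* `chernClassZ E i` — the Chern classes of the structure `ChernClassTheory`, extended to arbitrary
  bases by `c₀ = 1`, `cᵢ = 0` (the axioms only constrain paracompact Hausdorff bases);
* `theChernClassTheory : ChernClassTheory` and
  **`chernClassTheory_nonempty_holds : chernClassTheory_nonempty`**.

Everything is proved; no named facts.

## References

* D. Husemoller, *Fibre Bundles*, GTM 20, Springer 1994, Ch. 17 Def. 2.6, Prop. 3.3, Thm. 6.2. [HusemollerFibreBundles1994]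
-/

noncomputable section

open CategoryTheory Function Set Bundle Module Literature.AlgebraicTopology.SingularHomology

namespace Literature.AlgebraicTopology.CharacteristicClasses

open ComplexVectorBundle

/-- **The integral Chern classes** `cᵢ(E) ∈ H²ⁱ(B; ℤ)`: Grothendieck's classes over paracompact
Hausdorff bases, `c₀ = 1`, `cᵢ = 0` (`i > 0`) on other bases. [cite: HusemollerFibreBundles1994, Ch. 17 Def. 2.6] -/
def chernClassZ {B : Type} [TopologicalSpace B] (E : ComplexVectorBundle.{0, 0} B) (i : ℕ) : singularCohomology ℤ ℤ B (2 * i) :=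
  open Classical in
  if h : T2Space B ∧ ParacompactSpace B then @ComplexVectorBundle.chernClassR B _ h.1 h.2 E ℤ _ i
  else if hi : i = 0 then degCast ℤ (show 0 = 2 * i by omega) (singularCohomology.one ℤ B) else 0

/-- Over a paracompact Hausdorff base these are Grothendieck's classes. [folklore] -/
theorem chernClassZ_eq {B : Type} [TopologicalSpace B] [T2Space B] [ParacompactSpace B] (E : ComplexVectorBundle.{0, 0} B) (i : ℕ) :
    chernClassZ E i = E.chernClassR ℤ i := by
  rw [chernClassZ, dif_pos ⟨‹_›, ‹_›⟩]

/-- `c₀ = 1` on every base. [cite: HusemollerFibreBundles1994, Ch. 17 Prop. 3.3] -/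
theorem chernClassZ_zero {B : Type} [TopologicalSpace B] (E : ComplexVectorBundle.{0, 0} B) : chernClassZ E 0 = singularCohomology.one ℤ B := by
  rw [chernClassZ]
  by_cases h : T2Space B ∧ ParacompactSpace B
  · rw [dif_pos h]
    exact @ComplexVectorBundle.chernClassR_zero B _ h.1 h.2 E ℤ _
  · rw [dif_neg h, dif_pos rfl]
    rfl

/-- `cᵢ = 0` for `i > rank` on every base. [cite: HusemollerFibreBundles1994, Ch. 17 Prop. 3.3] -/
theorem chernClassZ_eq_zero_of_rank_lt {B : Type} [TopologicalSpace B] (E : ComplexVectorBundle.{0, 0} B) {i : ℕ} (hi : E.rank < i) :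
    chernClassZ E i = 0 := by
  rw [chernClassZ]
  by_cases h : T2Space B ∧ ParacompactSpace B
  · rw [dif_pos h]
    exact @ComplexVectorBundle.chernClassR_eq_zero_of_lt B _ h.1 h.2 E ℤ _ i hi
  · rw [dif_neg h, dif_neg (by omega)]

/-- `span {-x} = span {x}`. [folklore] -/
theorem span_singleton_neg_eq {S : Type*} [Ring S] {M : Type*} [AddCommGroup M] [Module S M] (x : M) :
    Submodule.span S ({-x} : Set M) = Submodule.span S {x} := by
  rw [show -x = ((-1 : Sˣ) : S) • x by simp]
  exact Submodule.span_singleton_smul_eq (Units.isUnit _) x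

/-- **The theory of Chern classes** (Husemoller Ch. 17: Def. 2.6, Prop. 3.3, Thm. 6.2).
[cite: HusemollerFibreBundles1994, Ch. 17 Def. 2.6, Prop. 3.3, Thm. 6.2] -/
def theChernClassTheory : ChernClassTheory where
  chernClass := chernClassZ
  chernClass_zero := chernClassZ_zero
  chernClass_eq_zero_of_rank_lt E _ hi := chernClassZ_eq_zero_of_rank_lt E hi
  chernClass_congr e i := by
    rw [chernClassZ_eq, chernClassZ_eq]
    exact ComplexVectorBundle.chernClassR_congr ℤ e i
  chernClass_pullback f E i := by
    rw [chernClassZ_eq, chernClassZ_eq]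
    exact ComplexVectorBundle.chernClassR_pullback E ℤ f i
  chernClass_directSum E₁ E₂ m := by
    simp only [chernClassZ_eq]
    exact ComplexVectorBundle.chernClassR_directSum ℤ E₁ E₂ m
  span_chernClass_tautological := by
    rw [chernClassZ_eq, ComplexVectorBundle.chernClassR_one_of_rank_one tautologicalLineBundle ℤ rank_tautologicalLineBundle,
      span_singleton_neg_eq]
    exact span_firstChernClass_tautological

/-- **Discharge of the named fact `chernClassTheory_nonempty`: Chern classes satisfying (C₀)–(C₃)
exist** (Husemoller Ch. 17, Def. 2.6, Prop. 3.3, Thm. 6.2). [cite: HusemollerFibreBundles1994, Ch. 17 Def. 2.6, Prop. 3.3 and Thm. 6.2] -/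
theorem chernClassTheory_nonempty_holds : chernClassTheory_nonempty := ⟨theChernClassTheory⟩

end Literature.AlgebraicTopology.CharacteristicClasses
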